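import Literature.GroupTheory.FiniteAbelian.AlternatingPairing
import Literature.NumberTheory.EllipticCurves.ShaPrimaryIsogenyProofs
import HarnessLib

/-!
# The radical of an adjoint pairing on `ker Ψ` is `Φ(A[p])` when `Φ` is injective — the algebra of
# the two-engine AGREE and of the `LINES = one` reading (cell `b2b-bsdres`, CLASS-CLOSURE instrument
# builder 4 = seat cc-eng-4, GEN 103; instrument B-24, implementations 1 `ctp3iso` / 2 `phisel3`)

HONEST FRAMING (cell `b2b-bsdres`, run/shared/lean/b2b/bsd-rank1-residual/, verbatim in every
file): the goal of the cell is to DELETE the COMBINATION-SHAPED residual classes of the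
Birch–Swinnerton-Dyer formula for ALL analytic-rank `≤ 1` elliptic curves over `ℚ` — "full BSD
formula for every rank `≤ 1` curve in class `C`" assembled STRICTLY from published theorems — so
that the rank-`≤ 1` remainder becomes exactly the CONSTRUCTION-SHAPED classes, which are TYPED
(missing-input `Prop`s), NOT attempted. This is not "finishing BSD". THIS FILE is a class-free TOOL
file of pure finite-abelian-group algebra (no number theory imported); THEOREMS ONLY (no definition,
no named fact, no `sorry`); it asserts nothing about any curve, closes no item, books nothing.

## What this file records

The abstract setting of a dual pair of isogenies of prime degree `p` acting on two FINITE
Tate–Shafarevich groups (Cassels 1965; Milne, *ADT* I §6; the tree's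
`Literature.GroupTheory.FiniteAbelian.IsogenyPairParityFinite`): finite abelian groups `A`, `G`,
homomorphisms `Φ : A → G`, `Ψ : G → A` with `Ψ ∘ Φ = p`, `Φ ∘ Ψ = p`, a bi-additive pairing
`b′ : G × G → Q` with trivial left kernel whose `p`-torsion values embed in `𝔽_p`
(`ι : Q[p] ↪ ℤ/p`, as for `Q = ℚ/ℤ`), and `Φ(A[p])` orthogonal to `H := ker Ψ` under `b′` (which is
what ADJOINTNESS `b′(Φ a, y) = b(a, Ψ y)` gives). For the cell's instrument B-24 (`W = W₀`,
`W′ = Ê`, `Φ = Ш(φ)`, `Ψ = Ш(φ̂)`, `b′` = Cassels–Tate on `Ш(Ê)`): implementation 1 (`ctp3iso`)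
returns the RADICAL `kernel₁ := {x ∈ H : b′(x, H) = 0}` of the pairing on `H = Ш(Ê)[φ̂]` (modulo
Mordell–Weil),
implementation 2 (`phisel3`) returns `kernel₂ := H ⊓ range Φ = Φ(A[p])` (Creutz–Miller Lemma 2.3),
and the cross-read AGREE (K-CC-2) is `kernel₁ = kernel₂`.

* **`exists_torsion_preimage_of_orthogonal_ker`** — if `Φ` is INJECTIVE (`Ш(W₀)[φ] = 0`), every
  `x ∈ ker Ψ` orthogonal to `ker Ψ` lies in `Φ(A[p])`: `kernel₁ ⊆ kernel₂`. The reverse inclusion is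
  adjointness alone (`SecondDescent/PhiCoveringDescentCertificate.lean`,
  `ker_inf_range_orthogonal_of_adjoint`), so **AGREE is forced by the published facts once
  `Ш(W₀)[φ] = 0` and both `Ш` are finite**: a DISAGREE on such a row can only be an engine defect —
  which is what makes K-CC-2 an engineering check rather than an arithmetic experiment. Counting
  proof in `𝔽_p`-vector spaces, after the tree's `natCard_ker_mul_card_le`: the subgroup `S` of such
  `x` is killed by `p`; `x ↦ ι ∘ b′(x, ·)` is an injective `𝔽_p`-linear map from `S` to the dual of
  `(G/ker Ψ)/p`, a space of order `#(G/ker Ψ)[p] ≤ #A[p]` (`G/ker Ψ ↪ A`); so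
  `#S ≤ #A[p] = #Φ(A[p])`, while `Φ(A[p]) ⊆ S`. (This is the finite-level case, under injectivity,
  of   Fisher, J. Number Theory 98 (2003) Thm. 3, equivalently of Creutz–Miller's Remark 2.4
  "`#Ш(E′)[φ′]/φ(Ш(E)[ℓ])` is a square" — proved here, not cited as a fact.)
* **`forall_nsmul_eq_zero_of_one_empty`** — the `LINES = one` reading (Creutz–Miller Remark 7.1,
  "a second `φ`-descent on any of the nontrivial elements"): if moreover `b′` is ALTERNATING,
  `#ker Ψ = p²` and ONE class `x₀ ∈ ker Ψ` is NOT in `range Φ` (its `Φ`-Selmer set is EMPTY), then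
  `A[p] = 0` — a non-zero `a ∈ A[p]` would give `y := Φ a ≠ 0` orthogonal to `ker Ψ` with
  `ker Ψ = ⟨x₀, y⟩`, making `x₀` orthogonal to `ker Ψ`, hence in `Φ(A[p]) ⊆ range Φ`.

The `Ш`-level and `ℚ`-level consumers (Cassels–Tate pairings from the tree's named fact
`exists_casselsTate_pairing_adjoint`, finiteness from Gross–Zagier–Kolyvagin) are in
`SecondDescent/PhiCoveringDescentAgreement.lean`.

## Part 2 (GEN 104): the same on the tree's `Ш`

§2 `exists_sha_torsion_preimage_of_casselsTate_orthogonal` and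
`sha_torsion_eq_zero_of_shaMap_injective_of_one_phiCovering_empty`: §1 instantiated on `Ш(φ)`,
`Ш(ψ)` for a dual pair of isogenies of prime degree over a number field (`shaMap`,
`Isogeny.shaMap_shaMap_eq_nsmul`), both `Ш` finite, the adjoint Cassels–Tate pairings as DISPLAYED
binders `B`, `B′` (Milne *ADT* I 6.9 / 6.10(a) / 6.13(a); nothing instantiated). This is the content
drafted as `SecondDescent/PhiCoveringDescentAgreement.lean` (cell file
`class-closure/eng-4/lean/gen103-queued/`), filed as an APPEND to this module under the cell lead's
device (HOME INBOX l.17765) and the chair's ★ R-110-DEV (l.17784) while this module's olean was not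
yet built on the farm. SUPERSEDES the sentence above naming `PhiCoveringDescentAgreement.lean`: no
such module is filed — the `Ш`-level consumers are §2 below, and the `ℚ`-level END is
`SecondDescent/PhiCoveringSquareCount.lean`'s `bsdp_of_shaMap_injective_of_one_phiCovering_empty_sq`
(one-curve Cassels–Tate only; not repeated here).

References (context only): Creutz–Miller, J. Algebra 372 (2012) Lemma 2.3, Rem. 2.4, Rem. 7.1;
Fisher, J. Number Theory 98 (2003) Thm. 3; Cassels, J. reine angew. Math. 217 (1965); Milne, *ADT* I
Prop. 6.9, Rem. 6.10(a), Thm. 6.13(a) [MilneADT2006]; cell files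
`class-closure/eng-4/b24i2/DESIGN-B24-IMPL2-v0.md` §(2)(g), `class-closure/STRUCTURE-cc.md` K-CC-2.
-/

set_option autoImplicit false

noncomputable section

open scoped Classical
open scoped AddSubgroup

open Module Literature.GroupTheory.FiniteAbelian

namespace Summit.BirchSwinnertonDyer.Rank1Residual.SecondDescent.PhiCovering

section Algebra

variable {A G : Type*} [AddCommGroup A] [AddCommGroup G] {Q : Type*} [AddCommGroup Q]
  (p : ℕ) [hp : Fact p.Prime]

/-- **`kernel₁ ⊆ kernel₂`: every class of `ker Ψ` orthogonal to `ker Ψ` comes from `A[p]`, when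
`Φ` is injective** (hypotheses as in the module docstring, §1). The subgroup `S` of such classes is
killed by `p`; `x ↦ ι ∘ b′(x, ·)` is an injective `𝔽_p`-linear map from `S` to the dual of
`(G / ker Ψ) / p`, of order `#(G/ker Ψ)[p] ≤ #A[p]` (`G/ker Ψ ↪ A`); so `#S ≤ #A[p] = #Φ(A[p])`,
and `Φ(A[p]) ⊆ S`, whence `S = Φ(A[p])`. -/
theorem exists_torsion_preimage_of_orthogonal_ker [Finite A] [Finite G]
    (ι : Q[(p : ℤ)] →+ ZMod p) (hι : Function.Injective ι)
    (b' : G →+ G →+ Q) (hnd : ∀ x, (∀ y, b' x y = 0) → x = 0)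
    (Φ : A →+ G) (Ψ : G →+ A) (hΨΦ : ∀ a, Ψ (Φ a) = p • a) (hΦΨ : ∀ x, Φ (Ψ x) = p • x)
    (hinj : Function.Injective Φ)
    (horth : ∀ a : A, p • a = 0 → ∀ h, Ψ h = 0 → b' (Φ a) h = 0)
    {x : G} (hx : Ψ x = 0) (hxo : ∀ h, Ψ h = 0 → b' x h = 0) :
    ∃ a : A, p • a = 0 ∧ Φ a = x := by
  -- the subgroup `S` of classes of `ker Ψ` orthogonal to `ker Ψ`
  let S : AddSubgroup G :=
    { carrier := {x | Ψ x = 0 ∧ ∀ h, Ψ h = 0 → b' x h = 0}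
      zero_mem' := ⟨map_zero Ψ, fun h _ ↦ by rw [map_zero, AddMonoidHom.zero_apply]⟩
      add_mem' := by
        rintro u v ⟨hu, hu'⟩ ⟨hv, hv'⟩
        exact ⟨by rw [map_add, hu, hv, add_zero], fun h hh ↦ by
          rw [map_add, AddMonoidHom.add_apply, hu' h hh, hv' h hh, add_zero]⟩
      neg_mem' := by
        rintro u ⟨hu, hu'⟩
        exact ⟨by rw [map_neg, hu, neg_zero], fun h hh ↦ by
          rw [map_neg, AddMonoidHom.neg_apply, hu' h hh, neg_zero]⟩ }
  have hxS : x ∈ S := ⟨hx, hxo⟩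
  -- `R = Φ(A[p]) ≤ S`
  have hRS : (A[(p : ℤ)]).map Φ ≤ S := by
    rintro _ ⟨a, ha, rfl⟩
    have hpa : p • a = 0 := AddSubgroup.torsionBy.nsmul_iff.mp ha
    exact ⟨by rw [hΨΦ, hpa], horth a hpa⟩
  -- it suffices to count: `#S ≤ #A[p]`
  suffices hcard : Nat.card S ≤ Nat.card (A[(p : ℤ)]) by
    have hR : Nat.card ((A[(p : ℤ)]).map Φ) = Nat.card (A[(p : ℤ)]) :=
      AddSubgroup.card_map_of_injective hinj
    have hEq : (A[(p : ℤ)]).map Φ = S :=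
      AddSubgroup.eq_of_le_of_card_ge hRS (by rw [hR]; exact hcard)
    have hx' : x ∈ (A[(p : ℤ)]).map Φ := by rw [hEq]; exact hxS
    obtain ⟨a, ha, hax⟩ := AddSubgroup.mem_map.mp hx'
    exact ⟨a, AddSubgroup.torsionBy.nsmul_iff.mp ha, hax⟩
  -- `S ⊆ G[p]`
  have hSp : ∀ s ∈ S, s ∈ G[(p : ℤ)] := fun s hs ↦ by
    rw [AddSubgroup.torsionBy.nsmul_iff, ← hΦΨ, hs.1, map_zero]
  -- the finite group `T₀ = G / ker Ψ ↪ A` and its quotient `T₀ / p T₀`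
  haveI : Finite (G ⧸ Ψ.ker) := Finite.of_surjective _ QuotientAddGroup.mk_surjective
  set R₂ : AddSubgroup (G ⧸ Ψ.ker) :=
    (LinearMap.range (LinearMap.lsmul ℤ (G ⧸ Ψ.ker) p)).toAddSubgroup with hR₂
  have hR₂p : ∀ t : G ⧸ Ψ.ker, p • t ∈ R₂ := fun t ↦ by
    rw [hR₂, ← range_nsmulAddMonoidHom_eq]
    exact ⟨t, rfl⟩
  haveI mV : Module (ZMod p) ((G ⧸ Ψ.ker) ⧸ R₂) := QuotientAddGroup.zmodModule hR₂p
  haveI : Finite ((G ⧸ Ψ.ker) ⧸ R₂) := Finite.of_surjective _ QuotientAddGroup.mk_surjective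
  haveI : Module.Finite (ZMod p) ((G ⧸ Ψ.ker) ⧸ R₂) := Module.Finite.of_finite
  haveI mS : Module (ZMod p) S := AddCommGroup.zmodModule fun s ↦ Subtype.ext (by
    rw [AddSubgroup.coe_nsmul, AddSubgroup.coe_zero]
    exact AddSubgroup.torsionBy.nsmul_iff.mp (hSp s s.2))
  haveI : Module.Finite (ZMod p) S := Module.Finite.of_finite
  -- `s ↦ b′(s, ·)` on `S`, with values in `Q[p]`, composed with `ι`
  let tS : S →+ G →+ Q[(p : ℤ)] :=
    { toFun := fun s ↦ (b' (s : G)).codRestrict (Q[(p : ℤ)])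
        (apply_mem_torsionBy b' p (hSp s s.2))
      map_zero' := by ext; simp
      map_add' := fun s t ↦ by ext; simp }
  have htS : ∀ (s : S) (g : G), ((tS s g : Q[(p : ℤ)]) : Q) = b' s g := fun _ _ ↦ rfl
  let b₁ : S →+ G →+ ZMod p := (AddMonoidHom.compHom ι).comp tS
  have hb₁ : ∀ (s : S) (g : G), b₁ s g = ι (tS s g) := fun _ _ ↦ rfl
  -- it kills `ker Ψ` in `g`: descend to `T₀ = G / ker Ψ`
  have hkill : ∀ s : S, Ψ.ker ≤ (b₁ s).ker := by
    intro s h hh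
    have h0 : tS s h = 0 := Subtype.ext (by
      rw [htS, ZeroMemClass.coe_zero]
      exact s.2.2 h (AddMonoidHom.mem_ker.mp hh))
    rw [AddMonoidHom.mem_ker, hb₁, h0, map_zero]
  let b₀ : S →+ (G ⧸ Ψ.ker →+ ZMod p) :=
    { toFun := fun s ↦ QuotientAddGroup.lift Ψ.ker (b₁ s) (hkill s)
      map_zero' := QuotientAddGroup.addMonoidHom_ext Ψ.ker (by
        ext g
        change b₁ 0 g = 0
        rw [map_zero, AddMonoidHom.zero_apply])
      map_add' := fun s t ↦ QuotientAddGroup.addMonoidHom_ext Ψ.ker (by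
        ext g
        change b₁ (s + t) g = b₁ s g + b₁ t g
        rw [map_add, AddMonoidHom.add_apply]) }
  have hb₀ : ∀ (s : S) (g : G), b₀ s (QuotientAddGroup.mk g) = b₁ s g := fun _ _ ↦ rfl
  -- values are killed by `p` (they live in `𝔽_p`): descend to `T₀ / p T₀`
  have hkill₂ : ∀ s : S, R₂ ≤ (b₀ s).ker := by
    intro s t ht
    rw [hR₂, ← range_nsmulAddMonoidHom_eq] at ht
    obtain ⟨t', rfl⟩ := ht
    rw [AddMonoidHom.mem_ker, nsmulAddMonoidHom_apply, map_nsmul, ← Nat.cast_smul_eq_nsmul (ZMod p),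
      ZMod.natCast_self, zero_smul]
  let b₂ : S →+ ((G ⧸ Ψ.ker) ⧸ R₂ →+ ZMod p) :=
    { toFun := fun s ↦ QuotientAddGroup.lift R₂ (b₀ s) (hkill₂ s)
      map_zero' := QuotientAddGroup.addMonoidHom_ext R₂ (by
        ext t
        change b₀ 0 t = 0
        rw [map_zero, AddMonoidHom.zero_apply])
      map_add' := fun s t ↦ QuotientAddGroup.addMonoidHom_ext R₂ (by
        ext u
        change b₀ (s + t) u = b₀ s u + b₀ t u
        rw [map_add, AddMonoidHom.add_apply]) }
  have hb₂ : ∀ (s : S) (g : G),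
      b₂ s (QuotientAddGroup.mk (QuotientAddGroup.mk g)) = ι (tS s g) := fun _ _ ↦ rfl
  let β : S →ₗ[ZMod p] Module.Dual (ZMod p) ((G ⧸ Ψ.ker) ⧸ R₂) :=
    ((AddMonoidHom.toZModLinearMapEquiv p).toAddMonoidHom.comp b₂).toZModLinearMap p
  have hβ : ∀ (s : S) (g : G),
      β s (QuotientAddGroup.mk (QuotientAddGroup.mk g)) = ι (tS s g) := fun _ _ ↦ rfl
  -- `β` is injective since `b′` has trivial left kernel
  have hβinj : Function.Injective β := by
    rw [injective_iff_map_eq_zero]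
    intro s hs
    have hs0 : (s : G) = 0 := hnd _ fun g ↦ by
      have h1 : β s (QuotientAddGroup.mk (QuotientAddGroup.mk g)) = 0 := by
        rw [hs, LinearMap.zero_apply]
      rw [hβ] at h1
      rw [← htS, hι (h1.trans ι.map_zero.symm), ZeroMemClass.coe_zero]
    exact Subtype.ext hs0
  -- dimensions, then cardinalities: `#S ≤ #(T₀ / p T₀) = #T₀[p] ≤ #A[p]`
  have hfin : finrank (ZMod p) S ≤ finrank (ZMod p) ((G ⧸ Ψ.ker) ⧸ R₂) := by
    have h := LinearMap.finrank_le_finrank_of_injective hβinj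
    rwa [Subspace.dual_finrank_eq] at h
  have h1 : Nat.card S ≤ Nat.card ((G ⧸ Ψ.ker) ⧸ R₂) := by
    rw [← pow_finrank_eq_natCard p S, ← pow_finrank_eq_natCard p ((G ⧸ Ψ.ker) ⧸ R₂)]
    exact Nat.pow_le_pow_right hp.out.pos hfin
  have h2 : Nat.card ((G ⧸ Ψ.ker) ⧸ R₂) = Nat.card (G ⧸ Ψ.ker)[(p : ℤ)] := by
    rw [natCard_torsionBy_eq_natCard_modN p]
    exact rfl
  have h3 : Nat.card (G ⧸ Ψ.ker)[(p : ℤ)] ≤ Nat.card (A[(p : ℤ)]) := by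
    refine Nat.card_le_card_of_injective
      (fun t ↦ ⟨QuotientAddGroup.kerLift Ψ (t : G ⧸ Ψ.ker), ?_⟩) ?_
    · rw [AddSubgroup.torsionBy.nsmul_iff, ← map_nsmul, AddSubgroup.torsionBy.nsmul_iff.mp t.2,
        map_zero]
    · intro t t' htt
      exact Subtype.ext (QuotientAddGroup.kerLift_injective Ψ (congrArg Subtype.val htt))
  calc Nat.card S ≤ Nat.card ((G ⧸ Ψ.ker) ⧸ R₂) := h1
    _ = Nat.card (G ⧸ Ψ.ker)[(p : ℤ)] := h2
    _ ≤ Nat.card (A[(p : ℤ)]) := h3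

/-- **The `LINES = one` reading (Creutz–Miller Remark 7.1), abstract form.** In the setting of
`exists_torsion_preimage_of_orthogonal_ker` with `b′` moreover ALTERNATING: if `#ker Ψ = p²` and ONE
class `x₀ ∈ ker Ψ` is NOT in `range Φ` (its `Φ`-Selmer set is EMPTY), then `A[p] = 0`: a non-zero
`a ∈ A[p]` would give `y := Φ a ≠ 0` orthogonal to `ker Ψ` with `ker Ψ = ⟨x₀, y⟩`, making `x₀`
orthogonal to `ker Ψ`, hence in `Φ(A[p]) ⊆ range Φ`. -/
theorem forall_nsmul_eq_zero_of_one_empty [Finite A] [Finite G]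
    (ι : Q[(p : ℤ)] →+ ZMod p) (hι : Function.Injective ι)
    (b' : G →+ G →+ Q) (halt : ∀ x, b' x x = 0) (hnd : ∀ x, (∀ y, b' x y = 0) → x = 0)
    (Φ : A →+ G) (Ψ : G →+ A) (hΨΦ : ∀ a, Ψ (Φ a) = p • a) (hΦΨ : ∀ x, Φ (Ψ x) = p • x)
    (hinj : Function.Injective Φ)
    (horth : ∀ a : A, p • a = 0 → ∀ h, Ψ h = 0 → b' (Φ a) h = 0)
    (hcardH : Nat.card Ψ.ker = p ^ 2)
    {x₀ : G} (hx₀ : Ψ x₀ = 0) (hempty : ∀ a : A, Φ a ≠ x₀) :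
    ∀ a : A, p • a = 0 → a = 0 := by
  intro a hpa
  by_contra ha0
  -- `y := Φ a ≠ 0`, a class of `ker Ψ` orthogonal to `ker Ψ`, of order `p`
  have hy0 : Φ a ≠ 0 := fun h ↦ ha0 (hinj (by rw [h, map_zero]))
  have hyH : Φ a ∈ Ψ.ker := by rw [AddMonoidHom.mem_ker, hΨΦ, hpa]
  have hpy : p • Φ a = 0 := by rw [← map_nsmul, hpa, map_zero]
  have hoy : addOrderOf (Φ a) = p := addOrderOf_eq_prime hpy hy0
  -- `⟨y⟩ < ⟨x₀, y⟩ ≤ ker Ψ`, so `⟨x₀, y⟩ = ker Ψ` by counting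
  set C : AddSubgroup G := AddSubgroup.closure {x₀, Φ a} with hC
  have hCH : C ≤ Ψ.ker := by
    rw [hC, AddSubgroup.closure_le]
    rintro z (rfl | rfl)
    · exact AddMonoidHom.mem_ker.mpr hx₀
    · exact hyH
  have hZC : AddSubgroup.zmultiples (Φ a) ≤ C := by
    rw [AddSubgroup.zmultiples_le, hC]
    exact AddSubgroup.subset_closure (Or.inr rfl)
  have hx₀C : x₀ ∈ C := by rw [hC]; exact AddSubgroup.subset_closure (Or.inl rfl)
  have hx₀Z : x₀ ∉ AddSubgroup.zmultiples (Φ a) := by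
    rintro ⟨k, hk⟩
    exact hempty (k • a) (by rw [map_zsmul]; exact hk)
  haveI : Finite Ψ.ker := inferInstance
  have hCcard : Nat.card C = p ^ 2 := by
    have hdvd : Nat.card C ∣ p ^ 2 := by rw [← hcardH]; exact AddSubgroup.card_dvd_of_le hCH
    obtain ⟨k, hk, hCk⟩ := (Nat.dvd_prime_pow hp.out).mp hdvd
    have hZcard : Nat.card (AddSubgroup.zmultiples (Φ a)) = p := by
      rw [Nat.card_zmultiples, hoy]
    -- `⟨y⟩ ≠ C`, so `#C > p`
    have hlt : p < Nat.card C := by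
      by_contra hle
      have hEq : AddSubgroup.zmultiples (Φ a) = C :=
        AddSubgroup.eq_of_le_of_card_ge hZC (by rw [hZcard]; exact not_lt.mp hle)
      exact hx₀Z (hEq ▸ hx₀C)
    rw [hCk] at hlt ⊢
    interval_cases k
    · exfalso; rw [pow_zero] at hlt; exact Nat.lt_irrefl _ (lt_trans hp.out.one_lt hlt)
    · exfalso; rw [pow_one] at hlt; exact Nat.lt_irrefl _ hlt
    · rfl
  have hCeq : C = Ψ.ker := AddSubgroup.eq_of_le_of_card_ge hCH (by rw [hcardH, hCcard])
  -- `x₀` is orthogonal to `⟨x₀, y⟩ = ker Ψ`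
  have hx₀o : ∀ h, Ψ h = 0 → b' x₀ h = 0 := by
    intro h hh
    have hhC : h ∈ C := by rw [hCeq]; exact AddMonoidHom.mem_ker.mpr hh
    have hker : C ≤ (b' x₀).ker := by
      rw [hC, AddSubgroup.closure_le]
      rintro z (rfl | rfl)
      · exact AddMonoidHom.mem_ker.mpr (halt _)
      · rw [SetLike.mem_coe, AddMonoidHom.mem_ker, eq_neg_of_alternating b' halt, neg_eq_zero]
        exact horth a hpa x₀ hx₀
    exact AddMonoidHom.mem_ker.mp (hker hhC)
  -- hence `x₀ ∈ Φ(A[p]) ⊆ range Φ`: contradiction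
  obtain ⟨a₀, -, ha₀⟩ := exists_torsion_preimage_of_orthogonal_ker p ι hι b' hnd Φ Ψ hΨΦ hΦΨ hinj
    horth hx₀ hx₀o
  exact hempty a₀ ha₀

end Algebra

/-! ### §2 (Part 2) `Ш` along a dual pair of isogenies, both `Ш` finite -/

section Sha

open WeierstrassCurve Literature.NumberTheory.EllipticCurves

universe u

variable {K : Type u} [Field K] [NumberField K] {W W' : WeierstrassCurve K}

/-- **The two-engine AGREE on `Ш` is a theorem.** Let `φ : W → W′`, `ψ : W′ → W` be a dual pair of
isogenies of prime degree `p` over a number field with `Ш(W)`, `Ш(W′)` FINITE, and `B`, `B′`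
bi-additive `ℚ/ℤ`-valued pairings making `Ш(φ)`, `Ш(ψ)` ADJOINT, `B′` non-degenerate (the
Cassels–Tate pairings: Milne *ADT* I 6.9, 6.10(a), 6.13(a); kernel = divisible elements = `0` in a
finite group). If `Ш(φ)` is injective, every class of `ker Ш(ψ)` that is `B′`-orthogonal to
`ker Ш(ψ)` (implementation 1's kernel) lies in `Ш(φ)(Ш(W)[p])` (implementation 2's kernel).
[cite: MilneADT2006, Ch. I Remark 6.10(a)] -/
theorem exists_sha_torsion_preimage_of_casselsTate_orthogonal [W.IsElliptic] [W'.IsElliptic]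
    [Finite W.sha] [Finite W'.sha] (φ : Isogeny W W') (ψ : Isogeny W' W)
    (hψφ : ∀ P : W.geomPoints, ψ (φ P) = (φ.degree : ℤ) • P) {p : ℕ} [Fact p.Prime]
    (hdeg : φ.degree = p)
    (B : W.sha →+ W.sha →+ AddCircle (1 : ℚ)) (B' : W'.sha →+ W'.sha →+ AddCircle (1 : ℚ))
    (hadj : ∀ a b,
      B' (shaMap φ.toAddMonoidHom φ.equivariant φ.hasLocalPointsMaps_toAddMonoidHom a) b =
        B a (shaMap ψ.toAddMonoidHom ψ.equivariant ψ.hasLocalPointsMaps_toAddMonoidHom b))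
    (hnd : ∀ x : W'.sha, (∀ y, B' x y = 0) → x = 0)
    (hinj : Function.Injective
      (shaMap φ.toAddMonoidHom φ.equivariant φ.hasLocalPointsMaps_toAddMonoidHom))
    {x : W'.sha}
    (hx : shaMap ψ.toAddMonoidHom ψ.equivariant ψ.hasLocalPointsMaps_toAddMonoidHom x = 0)
    (hxo : ∀ h : W'.sha,
      shaMap ψ.toAddMonoidHom ψ.equivariant ψ.hasLocalPointsMaps_toAddMonoidHom h = 0 →
        B' x h = 0) :
    ∃ z : W.sha, (φ.degree : ℤ) • z = 0 ∧
      shaMap φ.toAddMonoidHom φ.equivariant φ.hasLocalPointsMaps_toAddMonoidHom z = x := by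
  obtain ⟨ι, hι⟩ := exists_circleTorsion_toZMod_injective p
  have hΨΦ : ∀ a : W.sha, shaMap ψ.toAddMonoidHom ψ.equivariant ψ.hasLocalPointsMaps_toAddMonoidHom
      (shaMap φ.toAddMonoidHom φ.equivariant φ.hasLocalPointsMaps_toAddMonoidHom a) = p • a :=
    fun a ↦ by rw [Isogeny.shaMap_shaMap_eq_nsmul φ ψ hψφ, hdeg]
  have hΦΨ : ∀ y : W'.sha, shaMap φ.toAddMonoidHom φ.equivariant φ.hasLocalPointsMaps_toAddMonoidHom
      (shaMap ψ.toAddMonoidHom ψ.equivariant ψ.hasLocalPointsMaps_toAddMonoidHom y) = p • y :=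
    fun y ↦ by rw [Isogeny.shaMap_shaMap_eq_nsmul' φ ψ hψφ, hdeg]
  have horth : ∀ a : W.sha, p • a = 0 → ∀ h : W'.sha,
      shaMap ψ.toAddMonoidHom ψ.equivariant ψ.hasLocalPointsMaps_toAddMonoidHom h = 0 →
        B' (shaMap φ.toAddMonoidHom φ.equivariant φ.hasLocalPointsMaps_toAddMonoidHom a) h = 0 :=
    fun a _ h hh ↦ by rw [hadj, hh, map_zero]
  obtain ⟨z, hz, hzx⟩ := exists_torsion_preimage_of_orthogonal_ker p ι hι B' hnd _ _ hΨΦ hΦΨ hinj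
    horth hx hxo
  exact ⟨z, by rw [hdeg, natCast_zsmul]; exact hz, hzx⟩

/-- **`LINES = one` on `Ш`: one EMPTY class, `#Ш(W′)[ψ] = p²` and `Ш(W)[φ] = 0` give
`Ш(W)[deg φ] = 0`** (both `Ш` finite; `B`, `B′` adjoint with `B′` alternating and non-degenerate;
`forall_nsmul_eq_zero_of_one_empty`) — Creutz–Miller's Remark 7.1 as a kernel statement. The
companion `SecondDescent/PhiCoveringSquareCount.lean` proves the same from the pairing on `Ш(W)`
alone. [cite: MilneADT2006, Ch. I Remark 6.10(a)] -/
theorem sha_torsion_eq_zero_of_shaMap_injective_of_one_phiCovering_empty [W.IsElliptic]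
    [W'.IsElliptic] [Finite W.sha] [Finite W'.sha] (φ : Isogeny W W') (ψ : Isogeny W' W)
    (hψφ : ∀ P : W.geomPoints, ψ (φ P) = (φ.degree : ℤ) • P) {p : ℕ} [Fact p.Prime]
    (hdeg : φ.degree = p)
    (B : W.sha →+ W.sha →+ AddCircle (1 : ℚ)) (B' : W'.sha →+ W'.sha →+ AddCircle (1 : ℚ))
    (hadj : ∀ a b,
      B' (shaMap φ.toAddMonoidHom φ.equivariant φ.hasLocalPointsMaps_toAddMonoidHom a) b =
        B a (shaMap ψ.toAddMonoidHom ψ.equivariant ψ.hasLocalPointsMaps_toAddMonoidHom b))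
    (halt : ∀ x : W'.sha, B' x x = 0) (hnd : ∀ x : W'.sha, (∀ y, B' x y = 0) → x = 0)
    (hinj : Function.Injective
      (shaMap φ.toAddMonoidHom φ.equivariant φ.hasLocalPointsMaps_toAddMonoidHom))
    (hcardH : Nat.card
      (shaMap ψ.toAddMonoidHom ψ.equivariant ψ.hasLocalPointsMaps_toAddMonoidHom).ker = p ^ 2)
    {x₀ : W'.sha}
    (hx₀ : shaMap ψ.toAddMonoidHom ψ.equivariant ψ.hasLocalPointsMaps_toAddMonoidHom x₀ = 0)
    (hempty : ∀ z : W.sha,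
      shaMap φ.toAddMonoidHom φ.equivariant φ.hasLocalPointsMaps_toAddMonoidHom z ≠ x₀) :
    ∀ z : W.sha, (φ.degree : ℤ) • z = 0 → z = 0 := by
  obtain ⟨ι, hι⟩ := exists_circleTorsion_toZMod_injective p
  have hΨΦ : ∀ a : W.sha, shaMap ψ.toAddMonoidHom ψ.equivariant ψ.hasLocalPointsMaps_toAddMonoidHom
      (shaMap φ.toAddMonoidHom φ.equivariant φ.hasLocalPointsMaps_toAddMonoidHom a) = p • a :=
    fun a ↦ by rw [Isogeny.shaMap_shaMap_eq_nsmul φ ψ hψφ, hdeg]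
  have hΦΨ : ∀ y : W'.sha, shaMap φ.toAddMonoidHom φ.equivariant φ.hasLocalPointsMaps_toAddMonoidHom
      (shaMap ψ.toAddMonoidHom ψ.equivariant ψ.hasLocalPointsMaps_toAddMonoidHom y) = p • y :=
    fun y ↦ by rw [Isogeny.shaMap_shaMap_eq_nsmul' φ ψ hψφ, hdeg]
  have horth : ∀ a : W.sha, p • a = 0 → ∀ h : W'.sha,
      shaMap ψ.toAddMonoidHom ψ.equivariant ψ.hasLocalPointsMaps_toAddMonoidHom h = 0 →
        B' (shaMap φ.toAddMonoidHom φ.equivariant φ.hasLocalPointsMaps_toAddMonoidHom a) h = 0 :=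
    fun a _ h hh ↦ by rw [hadj, hh, map_zero]
  intro z hz
  have hz' : p • z = 0 := by rw [← hdeg, ← natCast_zsmul]; exact hz
  exact forall_nsmul_eq_zero_of_one_empty p ι hι B' halt hnd _ _ hΨΦ hΦΨ hinj horth hcardH hx₀
    hempty z hz'

end Sha

end Summit.BirchSwinnertonDyer.Rank1Residual.SecondDescent.PhiCovering

end
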